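import Summits.ResolutionOfSingularities.ResolutionOfSingularities.Theorems.PurelyInseparableDim4PureLeafFpCentres
import Summits.ResolutionOfSingularities.ResolutionOfSingularities.Theorems.PurelyInseparableDim4GameDeterminacy
import HarnessLib
import HarnessLib.Audit.Tags

/-!
# Purely inseparable fourfolds — EVERY PURE LEAF WINS THE PLAIN GLOBAL GAME over `𝔽_p` at `q = p`, EVERY PRIME `p`,
# and MODE 1h TERMINATES from it (cell res-dim4-pi; D3c of `HOME/res-dim4-p-10/D3c-PAPER.md`, settled in the kernel)
# [OURS · counted 0 · a theorem about OUR coordinate-centre frame v4, not about resolution]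

Width seat `res-dim4-p-10` (g3).  The `p = 2` theorems `…PureLeafGlobalWinTheorem` / `…PureLeafMode1hTerminates` (D3b)
for EVERY prime `p`: for every `a : Fin 4 → ℕ` with some `p ∤ aᵢ` and every booking `(r, exc)`, over `K = ZMod p`, `q = p`:
**`stateWins_monomial_zmod`** — `StateWins p ⟨x^a, r, exc⟩` (A beats every sequence of `𝔽_p`-rational replies in the
tree's `Edge`, along-centre moves included); **`no_step1h_chain_monomial_zmod`** — no infinite `Step1h p` chain from
`⟨x^a, r, exc⟩` (every tie-break among least-cardinality centres, every `𝔽_p`-rational reply).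
THE CLASS (kits E–H, `…PureLeafSplitForms/FpForms/FpMoves/FpCentres`): ONE shape `expand p N(n)·(N(μ) − C γ(μ))`,
`N(m) = ∏ᵢ ∏_{c∈𝔽_p} (Xᵢ + C c)^{m i c}`, `γ(μ) = ∏∏ c^{μ i c}`, with (G1) `μ i c < p`, (G2) one active root per variable,
(G3) the `p`-th-power part of an active variable has the same root, (G4) some variable active.  MODE-1h centres at a
class state: singletons `{x_j}` with `n j 0 ≥ 1` (`isMode1hCentre_generalForm_singleton`), else — product regime only —
minimal blocks of pure variables (`isMode1hCentre_generalForm_block`); every edge maps `(n, μ)` to a root shift of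
`(n − δ_{(j,0)}, μ)` resp. `(n, μ[j,0 ↦ Σ_S μ i 0 − p])`, inside the class, with `W = Σ (p·n i c + μ i c)` smaller
(`edge_generalForm`); strong induction on `W` (`classWins`).
Riders: `𝔽_p`-rational replies only; every tie-break (so the engines' lex rule is covered); NOT F4-C; the all-`p`-divisible
leaf is excluded by hypothesis.  Class found by census (HOME `lean-g3/py/`), the kernel proof does not depend on it.
Nothing here proves `Terminates1h`, F4-C or resolution of singularities in dimension ≥ 4 / characteristic `p`; counted 0;
AI work, weaker than expert review. bears_on: LADDER-RESOLUTION:D157-DOOR2 (res-dim4-pi · D3c). Supports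
stmt-ResolutionOfSingularities-16155 (helper).
-/

set_option linter.dupNamespace false

open MvPolynomial Finset

open scoped BigOperators

noncomputable section
namespace Summit.ResolutionOfSingularities.ResolutionOfSingularities.Theorems.PIDim4

namespace PureLeafNF

open Literature.AlgebraicGeometry.Resolution
open Literature.AlgebraicGeometry.Resolution.Hauser2010
open CentreBlowup PthPowerFactor

variable (p : ℕ) [Fact p.Prime]

/-! ## 1. Invariants under the moves -/

/-- (G3) is kept by root shifts. [folklore] -/
theorem sameRoot_shift {n μ : Fin 4 → ZMod p → ℕ} (h3 : ∀ i c, μ i c ≠ 0 → ∀ c', c' ≠ c → n i c' = 0)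
    (b : Fin 4 → ZMod p) : ∀ i c, μ i (c - b i) ≠ 0 → ∀ c', c' ≠ c → n i (c' - b i) = 0 :=
  fun i c hc c' hc' => h3 i (c - b i) hc (c' - b i) (fun h => hc' (sub_left_injective h))

/-- (G4) is kept by root shifts. [folklore] -/
theorem active_shift {μ : Fin 4 → ZMod p → ℕ} (h4 : ∃ i c, μ i c ≠ 0) (b : Fin 4 → ZMod p) :
    ∃ i c, μ i (c - b i) ≠ 0 := by
  obtain ⟨i, c, hc⟩ := h4
  exact ⟨i, c + b i, by rwa [add_sub_cancel_right]⟩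

/-- (G3) is kept by the singleton chart `n j 0 ↦ n j 0 − 1` followed by a root shift. [folklore] -/
theorem sameRoot_singleton_chart {n μ : Fin 4 → ZMod p → ℕ} (h3 : ∀ i c, μ i c ≠ 0 → ∀ c', c' ≠ c → n i c' = 0)
    (j : Fin 4) (b : Fin 4 → ZMod p) :
    ∀ i c, μ i (c - b i) ≠ 0 → ∀ c', c' ≠ c →
      (if i = j ∧ c' - b i = 0 then n j 0 - 1 else n i (c' - b i)) = 0 := fun i c hc c' hc' => by
  have h := sameRoot_shift p h3 b i c hc c' hc'
  split_ifs with hij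
  · obtain ⟨rfl, h0⟩ := hij
    rw [h0] at h
    omega
  · exact h

/-! ## 2. MODE-1h centres at a class state -/

variable {K : Type} [Field K] in
omit [Fact p.Prime] in
/-- A state with a permissible centre has a MODE-1h centre (finitely many centres). [folklore] -/
theorem exists_isMode1hCentre_of_exists (q : ℕ) (F : MvPolynomial (Fin 4) K) (h : ∃ S, IsPermissibleCentre q S F) :
    ∃ S, IsMode1hCentre q S F := by
  classical
  obtain ⟨S₀, hS₀⟩ := h
  obtain ⟨S, hS, hmin⟩ := Finset.exists_min_image (Finset.univ.filter fun S => IsPermissibleCentre q S F) Finset.card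
    ⟨S₀, Finset.mem_filter.mpr ⟨Finset.mem_univ _, hS₀⟩⟩
  exact ⟨S, (Finset.mem_filter.mp hS).2, fun S' hS' => hmin S' (Finset.mem_filter.mpr ⟨Finset.mem_univ _, hS'⟩)⟩

/-- In the PRODUCT regime the constant is `C 0`. [folklore] -/
theorem generalForm_eq_of_gamma_eq_zero (n μ : Fin 4 → ZMod p → ℕ) (hγ : (∏ i, ∏ c, (c : ZMod p) ^ μ i c) = 0) :
    expand p (∏ i, ∏ c, (X i + C c) ^ n i c : MvPolynomial (Fin 4) (ZMod p)) *
        ((∏ i, ∏ c, (X i + C c) ^ μ i c) - C (∏ i, ∏ c, (c : ZMod p) ^ μ i c)) =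
      expand p (∏ i, ∏ c, (X i + C c) ^ n i c : MvPolynomial (Fin 4) (ZMod p)) *
        ((∏ i, ∏ c, (X i + C c) ^ μ i c) - C 0) := by
  rw [hγ]

/-- **A permissible singleton is `{x_j}` with `1 ≤ n j 0`** (both regimes). [folklore] -/
theorem one_le_of_isPermissibleCentre_singleton (n μ : Fin 4 → ZMod p → ℕ) (hμ : ∀ i c, μ i c < p)
    (h1 : ∀ i c, μ i c ≠ 0 → ∀ c', c' ≠ c → μ i c' = 0) (h4 : ∃ i c, μ i c ≠ 0) {j : Fin 4}
    (hS : IsPermissibleCentre p {j} (expand p (∏ i, ∏ c, (X i + C c) ^ n i c : MvPolynomial (Fin 4) (ZMod p)) *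
      ((∏ i, ∏ c, (X i + C c) ^ μ i c) - C (∏ i, ∏ c, (c : ZMod p) ^ μ i c)))) :
    1 ≤ n j 0 := by
  by_contra hlt
  have hj0 : n j 0 = 0 := by omega
  obtain ⟨-, hord⟩ := hS
  by_cases hγ : (∏ i, ∏ c, (c : ZMod p) ^ μ i c) = 0
  · -- product regime: the order along `{x_j}` is `p·n j 0 + μ j 0 = μ j 0 < p`
    rw [generalForm_eq_of_gamma_eq_zero p n μ hγ, ordAlong_generalForm_C_zero, Finset.sum_singleton, hj0, mul_zero,
      zero_add] at hord
    have : p ≤ μ j 0 := by exact_mod_cast hord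
    exact absurd (hμ j 0) (not_lt.mpr this)
  · -- bracket regime: the order along `{x_j}` is `≤ 1 < p`
    have hact : ∀ i c, μ i c ≠ 0 → c ≠ 0 := fun i c hc hc0 => hγ ((gamma_eq_zero_iff p μ).mpr ⟨i, by rwa [hc0] at hc⟩)
    obtain ⟨i₀, c₀, hi₀⟩ := h4
    have hle := ordAlong_singleton_generalForm_le_one p n μ (∏ i, ∏ c, (c : ZMod p) ^ μ i c) hμ h1 hact hi₀ hj0
    have h2 : (p : ℕ∞) ≤ 1 := le_trans hord hle
    have : p ≤ 1 := by exact_mod_cast h2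
    exact absurd (Fact.out : p.Prime).one_lt (not_lt.mpr this)

/-- **MODE-1h centres, case A**: if some `n j 0 ≥ 1` then every MODE-1h centre is a singleton `{x_{j'}}` with `n j' 0 ≥ 1`.
[folklore] -/
theorem isMode1hCentre_generalForm_singleton (n μ : Fin 4 → ZMod p → ℕ) (hμ : ∀ i c, μ i c < p)
    (h1 : ∀ i c, μ i c ≠ 0 → ∀ c', c' ≠ c → μ i c' = 0) (h4 : ∃ i c, μ i c ≠ 0) {j : Fin 4} (hj : 1 ≤ n j 0)
    {S : Finset (Fin 4)}
    (hS : IsMode1hCentre p S (expand p (∏ i, ∏ c, (X i + C c) ^ n i c : MvPolynomial (Fin 4) (ZMod p)) *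
      ((∏ i, ∏ c, (X i + C c) ^ μ i c) - C (∏ i, ∏ c, (c : ZMod p) ^ μ i c)))) :
    ∃ j', S = {j'} ∧ 1 ≤ n j' 0 := by
  obtain ⟨hperm, hmin⟩ := hS
  have hcard := hmin {j} ⟨Finset.singleton_nonempty j,
    le_ordAlong_singleton_generalForm p n μ (∏ i, ∏ c, (c : ZMod p) ^ μ i c) hj⟩
  rw [Finset.card_singleton] at hcard
  obtain ⟨j', hj'⟩ := Finset.card_eq_one.mp (le_antisymm hcard (Finset.card_pos.mpr hperm.1))
  refine ⟨j', hj', ?_⟩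
  rw [hj'] at hperm
  exact one_le_of_isPermissibleCentre_singleton p n μ hμ h1 h4 hperm

/-- **MODE-1h centres, case B**: if every `n j 0 = 0` then the state is a PRODUCT (`γ(μ) = 0`; the bracket regime has no
permissible centre) and every MODE-1h centre is a block `S` of pure variables with `p ≤ Σ_S μ i 0`, minimal
(`Σ_{S∖j} μ i 0 < p` for `j ∈ S`) and of cardinality `≥ 2`. [folklore] -/
theorem isMode1hCentre_generalForm_block (n μ : Fin 4 → ZMod p → ℕ) (hμ : ∀ i c, μ i c < p)
    (h1 : ∀ i c, μ i c ≠ 0 → ∀ c', c' ≠ c → μ i c' = 0) (h4 : ∃ i c, μ i c ≠ 0) (hn0 : ∀ j, n j 0 = 0)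
    {S : Finset (Fin 4)}
    (hS : IsMode1hCentre p S (expand p (∏ i, ∏ c, (X i + C c) ^ n i c : MvPolynomial (Fin 4) (ZMod p)) *
      ((∏ i, ∏ c, (X i + C c) ^ μ i c) - C (∏ i, ∏ c, (c : ZMod p) ^ μ i c)))) :
    (∏ i, ∏ c, (c : ZMod p) ^ μ i c) = 0 ∧ (∀ i ∈ S, μ i 0 ≠ 0) ∧ p ≤ (∑ i ∈ S, μ i 0) ∧
      (∀ j ∈ S, (∑ i ∈ S.erase j, μ i 0) < p) ∧ 2 ≤ S.card := by
  obtain ⟨hperm, hmin⟩ := hS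
  by_cases hγ : (∏ i, ∏ c, (c : ZMod p) ^ μ i c) = 0
  · have hordS : ∀ T : Finset (Fin 4), ordAlong T (expand p (∏ i, ∏ c, (X i + C c) ^ n i c :
        MvPolynomial (Fin 4) (ZMod p)) * ((∏ i, ∏ c, (X i + C c) ^ μ i c) - C (∏ i, ∏ c, (c : ZMod p) ^ μ i c))) =
        ((∑ i ∈ T, μ i 0 : ℕ) : ℕ∞) := fun T => by
      rw [generalForm_eq_of_gamma_eq_zero p n μ hγ, ordAlong_generalForm_C_zero]
      congr 1
      exact_mod_cast Finset.sum_congr rfl fun i _ => by rw [hn0 i, mul_zero, zero_add]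
    have hpS : p ≤ ∑ i ∈ S, μ i 0 := by
      have h := hperm.2; rw [hordS] at h; exact_mod_cast h
    -- minimality consequences
    have herase : ∀ j ∈ S, (∑ i ∈ S.erase j, μ i 0) < p := fun j hj => by
      by_contra hge
      rw [not_lt] at hge
      have hne : (S.erase j).Nonempty := by
        by_contra he
        rw [Finset.not_nonempty_iff_eq_empty] at he
        rw [he, Finset.sum_empty] at hge
        exact absurd hge (not_le.mpr (Fact.out : p.Prime).pos)
      have hpermE : IsPermissibleCentre p (S.erase j) (expand p (∏ i, ∏ c, (X i + C c) ^ n i c :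
          MvPolynomial (Fin 4) (ZMod p)) * ((∏ i, ∏ c, (X i + C c) ^ μ i c) - C (∏ i, ∏ c, (c : ZMod p) ^ μ i c))) :=
        ⟨hne, by rw [hordS]; exact_mod_cast hge⟩
      have := hmin _ hpermE
      rw [Finset.card_erase_of_mem hj] at this
      have hpos := Finset.card_pos.mpr hperm.1
      omega
    have hact : ∀ i ∈ S, μ i 0 ≠ 0 := fun i hi h0 => by
      have h := herase i hi
      have hS := Finset.add_sum_erase S (fun i => μ i 0) hi
      have hS' : μ i 0 + ∑ k ∈ S.erase i, μ k 0 = ∑ k ∈ S, μ k 0 := hS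
      omega
    have hcard : 2 ≤ S.card := by
      by_contra hlt
      have hpos := Finset.card_pos.mpr hperm.1
      have hc1 : S.card = 1 := by omega
      obtain ⟨j, hj⟩ := Finset.card_eq_one.mp hc1
      rw [hj, Finset.sum_singleton] at hpS
      exact absurd (hμ j 0) (not_lt.mpr hpS)
    exact ⟨hγ, hact, hpS, herase, hcard⟩
  · exfalso
    have hact : ∀ i c, μ i c ≠ 0 → c ≠ 0 := fun i c hc hc0 => hγ ((gamma_eq_zero_iff p μ).mpr ⟨i, by rwa [hc0] at hc⟩)
    obtain ⟨i₀, c₀, hi₀⟩ := h4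
    have hle := ordAlong_generalForm_le_one p n μ (∏ i, ∏ c, (c : ZMod p) ^ μ i c) hμ h1 hact hn0 hi₀ S
    have h2 : (p : ℕ∞) ≤ 1 := le_trans hperm.2 hle
    have : p ≤ 1 := by exact_mod_cast h2
    exact absurd (Fact.out : p.Prime).one_lt (not_lt.mpr this)

/-! ## 3. Every MODE-1h edge stays in the class and lowers the measure -/

/-- **THE EDGE LEMMA.** From a class state `F = expand N(n)·(N(μ) − C γ(μ))` (G1)–(G4), every edge of every MODE-1h centre
leads to a class state of strictly smaller measure `W = Σ (p·n i c + μ i c)`. [OURS · counted 0] [folklore] -/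
theorem edge_generalForm (s s' : State (ZMod p)) (n μ : Fin 4 → ZMod p → ℕ)
    (hF : s.F = expand p (∏ i, ∏ c, (X i + C c) ^ n i c : MvPolynomial (Fin 4) (ZMod p)) *
      ((∏ i, ∏ c, (X i + C c) ^ μ i c) - C (∏ i, ∏ c, (c : ZMod p) ^ μ i c)))
    (hμ : ∀ i c, μ i c < p) (h1 : ∀ i c, μ i c ≠ 0 → ∀ c', c' ≠ c → μ i c' = 0)
    (h3 : ∀ i c, μ i c ≠ 0 → ∀ c', c' ≠ c → n i c' = 0) (h4 : ∃ i c, μ i c ≠ 0)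
    {S : Finset (Fin 4)} (hS : IsMode1hCentre p S s.F) (hE : Edge p S s s') :
    ∃ n' μ' : Fin 4 → ZMod p → ℕ,
      s'.F = expand p (∏ i, ∏ c, (X i + C c) ^ n' i c : MvPolynomial (Fin 4) (ZMod p)) *
        ((∏ i, ∏ c, (X i + C c) ^ μ' i c) - C (∏ i, ∏ c, (c : ZMod p) ^ μ' i c)) ∧
      (∀ i c, μ' i c < p) ∧ (∀ i c, μ' i c ≠ 0 → ∀ c', c' ≠ c → μ' i c' = 0) ∧
      (∀ i c, μ' i c ≠ 0 → ∀ c', c' ≠ c → n' i c' = 0) ∧ (∃ i c, μ' i c ≠ 0) ∧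
      ∑ i, ∑ c, (p * n' i c + μ' i c) < ∑ i, ∑ c, (p * n i c + μ i c) := by
  obtain ⟨j, b, hjS, hbj, heq, hne, rfl⟩ := hE
  rw [hF] at hS
  have hp : 0 < p := (Fact.out : p.Prime).pos
  by_cases hA : ∃ j₀, 1 ≤ n j₀ 0
  · -- case A: the centre is a singleton `{x_j}` with `n j 0 ≥ 1`
    obtain ⟨j₀, hj₀⟩ := hA
    obtain ⟨j', rfl, hj'⟩ := isMode1hCentre_generalForm_singleton p n μ hμ h1 h4 hj₀ hS
    rw [Finset.mem_singleton] at hjS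
    subst hjS
    refine ⟨_, _, step_singleton_generalForm p s n μ (∏ i, ∏ c, (c : ZMod p) ^ μ i c) hF hμ h1 hj' b,
      small_shift hμ b, singleRoot_shift h1 b,
      sameRoot_singleton_chart p h3 j b, active_shift p h4 b, ?_⟩
    have hw := weight_singleton_chart p n μ hj'
    have hsh := weight_shift p (fun i c => if i = j ∧ c = 0 then n j 0 - 1 else n i c) μ b
    rw [hsh]
    omega
  · -- case B: a block of pure variables (product regime)
    push Not at hA
    have hn0 : ∀ j, n j 0 = 0 := fun j => by have := hA j; omega
    obtain ⟨hγ, hact, hpS, herase, hcard⟩ := isMode1hCentre_generalForm_block p n μ hμ h1 h4 hn0 hS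
    have hF0 : s.F = expand p (∏ i, ∏ c, (X i + C c) ^ n i c : MvPolynomial (Fin 4) (ZMod p)) *
        ((∏ i, ∏ c, (X i + C c) ^ μ i c) - C 0) := by rw [hF, hγ]
    have hnS : ∀ i ∈ S, ∀ c, n i c = 0 := fun i hi c => by
      by_cases hc : c = 0
      · rw [hc]; exact hn0 i
      · exact h3 i 0 (hact i hi) c hc
    have hμS : ∀ i ∈ S, ∀ c, c ≠ 0 → μ i c = 0 := fun i hi c hc => h1 i 0 (hact i hi) c hc
    have hlt : (∑ i ∈ S, μ i 0) - p < p := by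
      have h := herase j hjS
      have hS' : μ j 0 + ∑ i ∈ S.erase j, μ i 0 = ∑ i ∈ S, μ i 0 := Finset.add_sum_erase S (fun i => μ i 0) hjS
      have := hμ j 0
      omega
    refine ⟨_, _, step_block_generalForm p s n μ hF0 hμ h1 S hjS hnS hμS hlt b, ?_, ?_, ?_, ?_, ?_⟩
    · -- (G1)
      intro i c
      split_ifs
      · exact hlt
      · exact hμ i _
    · -- (G2)
      intro i c hc c' hc'
      by_cases hij : i = j
      · subst hij
        by_cases hc0 : c - b i = 0
        · rw [if_neg (fun h => hc' (sub_left_injective (h.2.trans hc0.symm)))]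
          exact hμS i hjS _ (fun h => hc' (sub_left_injective (h.trans hc0.symm)))
        · rw [if_neg (fun h => hc0 h.2)] at hc
          exact absurd (hμS i hjS _ hc0) hc
      · rw [if_neg (fun h => hij h.1)] at hc ⊢
        exact singleRoot_shift h1 b i c hc c' hc'
    · -- (G3)
      intro i c hc c' hc'
      by_cases hij : i = j
      · subst hij
        exact hnS i hjS _
      · rw [if_neg (fun h => hij h.1)] at hc
        exact sameRoot_shift p h3 b i c hc c' hc'
    · -- (G4): another pure variable of the block survives
      obtain ⟨k, hk, hkj⟩ : ∃ k ∈ S, k ≠ j := by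
        by_contra hno
        push Not at hno
        have : S ⊆ {j} := fun x hx => Finset.mem_singleton.mpr (hno x hx)
        have := Finset.card_le_card this
        rw [Finset.card_singleton] at this
        omega
      refine ⟨k, b k, ?_⟩
      rw [if_neg (fun h => hkj h.1), sub_self]
      exact hact k hk
    · -- the measure
      have hw := weight_block_chart_lt p n μ S hjS hpS (herase j hjS)
      have hsh := weight_shift p n (fun i c => if i = j ∧ c = 0 then (∑ i ∈ S, μ i 0) - p else μ i c) b
      rw [hsh]
      exact hw

/-! ## 4. The class is winning and terminating -/

/-- **THE PURE-LEAF CLASS OVER `𝔽_p` IS WINNING AND TERMINATING.** For every class state (G1)–(G4) and every booking: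
A wins the plain global game at `q = p`, and no infinite MODE-1h play starts there. [OURS · counted 0] [folklore] -/
theorem classWins : ∀ (W : ℕ) (n μ : Fin 4 → ZMod p → ℕ), ∑ i, ∑ c, (p * n i c + μ i c) ≤ W →
    (∀ i c, μ i c < p) → (∀ i c, μ i c ≠ 0 → ∀ c', c' ≠ c → μ i c' = 0) →
    (∀ i c, μ i c ≠ 0 → ∀ c', c' ≠ c → n i c' = 0) → (∃ i c, μ i c ≠ 0) →
    ∀ (r : Fin 4 →₀ ℕ) (exc : Finset (Fin 4)),
      StateWins p (⟨expand p (∏ i, ∏ c, (X i + C c) ^ n i c : MvPolynomial (Fin 4) (ZMod p)) *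
          ((∏ i, ∏ c, (X i + C c) ^ μ i c) - C (∏ i, ∏ c, (c : ZMod p) ^ μ i c)), r, exc⟩ : State (ZMod p)) ∧
      ¬ ∃ ch : ℕ → State (ZMod p),
        ch 0 = (⟨expand p (∏ i, ∏ c, (X i + C c) ^ n i c : MvPolynomial (Fin 4) (ZMod p)) *
          ((∏ i, ∏ c, (X i + C c) ^ μ i c) - C (∏ i, ∏ c, (c : ZMod p) ^ μ i c)), r, exc⟩ : State (ZMod p)) ∧
        ∀ k, Step1h p (ch k) (ch (k + 1)) := by
  intro W
  induction W using Nat.strong_induction_on with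
  | _ W IH =>
  intro n μ hW hμ h1 h3 h4 r exc
  have hstate : ∀ t : State (ZMod p), t = ⟨t.F, t.r, t.exc⟩ := fun t => rfl
  constructor
  · -- the game
    unfold StateWins
    by_cases hex : ∃ S, IsPermissibleCentre p S (expand p (∏ i, ∏ c, (X i + C c) ^ n i c :
        MvPolynomial (Fin 4) (ZMod p)) * ((∏ i, ∏ c, (X i + C c) ^ μ i c) - C (∏ i, ∏ c, (c : ZMod p) ^ μ i c)))
    · obtain ⟨S, hS⟩ := exists_isMode1hCentre_of_exists p _ hex
      refine Game.Wins.move (m := S) hS.1 fun s' hE => ?_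
      obtain ⟨n', μ', hF', hμ', h1', h3', h4', hlt⟩ := edge_generalForm p _ s' n μ rfl hμ h1 h3 h4 hS hE
      rw [hstate s', hF']
      exact ((IH _ (lt_of_lt_of_le hlt hW)) n' μ' le_rfl hμ' h1' h3' h4' _ _).1
    · exact Game.Wins.terminal fun S hS => hex ⟨S, hS⟩
  · -- termination
    rintro ⟨ch, h0, hch⟩
    obtain ⟨S, hS, hE⟩ := hch 0
    rw [h0] at hS hE
    obtain ⟨n', μ', hF', hμ', h1', h3', h4', hlt⟩ := edge_generalForm p _ _ n μ rfl hμ h1 h3 h4 hS hE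
    refine ((IH _ (lt_of_lt_of_le hlt hW)) n' μ' le_rfl hμ' h1' h3' h4' (ch 1).r (ch 1).exc).2
      ⟨fun k => ch (k + 1), ?_, fun k => hch (k + 1)⟩
    rw [hstate (ch (0 + 1))] 
    show (⟨(ch 1).F, (ch 1).r, (ch 1).exc⟩ : State (ZMod p)) = _
    rw [hF']

/-! ## 5. Pure leaves -/

/-- A pure leaf `x^a` with some `p ∤ aᵢ` in the general form: `n i 0 = aᵢ / p`, `μ i 0 = aᵢ % p`, nothing off the root `0`.
[folklore] -/
theorem monomial_eq_generalForm (a : Fin 4 → ℕ) (ha : ∃ i, ¬ p ∣ a i) :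
    (monomial (Finsupp.equivFunOnFinite.symm a) (1 : ZMod p)) =
      expand p (∏ i : Fin 4, ∏ c : ZMod p, (X i + C c) ^ (if c = 0 then a i / p else 0) : MvPolynomial (Fin 4) (ZMod p)) *
        ((∏ i : Fin 4, ∏ c : ZMod p, (X i + C c : MvPolynomial (Fin 4) (ZMod p)) ^ (if c = 0 then a i % p else 0)) -
          C (∏ i : Fin 4, ∏ c : ZMod p, (c : ZMod p) ^ (if c = 0 then a i % p else 0))) := by
  have hγ : (∏ i : Fin 4, ∏ c : ZMod p, (c : ZMod p) ^ (if c = 0 then a i % p else 0)) = 0 := by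
    obtain ⟨i, hi⟩ := ha
    exact (gamma_eq_zero_iff p _).mpr ⟨i, by rw [if_pos rfl]; exact fun h => hi (Nat.dvd_of_mod_eq_zero h)⟩
  have h1 := generalForm_C_zero p (fun (i : Fin 4) (c : ZMod p) => if c = 0 then a i / p else 0)
    (fun (i : Fin 4) (c : ZMod p) => if c = 0 then a i % p else 0)
  rw [hγ, h1, splitForm_eq_monomial_mul]
  have hunit : (∏ i : Fin 4, ∏ c ∈ Finset.univ.erase (0 : ZMod p),
      ((X i + C c : MvPolynomial (Fin 4) (ZMod p)) ^
        (p * (if c = 0 then a i / p else 0) + (if c = 0 then a i % p else 0)))) = 1 :=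
    Finset.prod_eq_one fun i _ => Finset.prod_eq_one fun c hc => by
      rw [if_neg (Finset.ne_of_mem_erase hc), if_neg (Finset.ne_of_mem_erase hc), mul_zero, add_zero, pow_zero]
  rw [hunit, mul_one]
  refine congrArg (fun d => monomial d (1 : ZMod p)) ?_
  ext i
  show a i = p * (if (0 : ZMod p) = 0 then a i / p else 0) + (if (0 : ZMod p) = 0 then a i % p else 0)
  rw [if_pos rfl, if_pos rfl, Nat.div_add_mod]

/-- **EVERY PURE LEAF WINS THE PLAIN GLOBAL GAME OVER `𝔽_p`, EVERY PRIME `p`**: for every exponent vector `a` with some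
`p ∤ aᵢ` and every booking, `StateWins p ⟨x^a, r, exc⟩` over `ZMod p`. [OURS · counted 0] [folklore] -/
theorem stateWins_monomial_zmod (a : Fin 4 → ℕ) (ha : ∃ i, ¬ p ∣ a i) (r : Fin 4 →₀ ℕ) (exc : Finset (Fin 4)) :
    StateWins p (⟨monomial (Finsupp.equivFunOnFinite.symm a) 1, r, exc⟩ : State (ZMod p)) := by
  rw [monomial_eq_generalForm p a ha]
  refine ((classWins p _ (fun (i : Fin 4) (c : ZMod p) => if c = 0 then a i / p else 0)
    (fun (i : Fin 4) (c : ZMod p) => if c = 0 then a i % p else 0) le_rfl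
    (fun i c => ?_) (fun i c hc c' hc' => ?_) (fun i c hc c' hc' => ?_) ?_ r exc)).1
  · split_ifs
    · exact Nat.mod_lt _ (Fact.out : p.Prime).pos
    · exact (Fact.out : p.Prime).pos
  · by_cases hc0 : c = 0
    · rw [if_neg (fun h => hc' (h.trans hc0.symm))]
    · rw [if_neg hc0] at hc; exact absurd rfl hc
  · by_cases hc0 : c = 0
    · rw [if_neg (fun h => hc' (h.trans hc0.symm))]
    · rw [if_neg hc0] at hc; exact absurd rfl hc
  · obtain ⟨i, hi⟩ := ha
    exact ⟨i, 0, by rw [if_pos rfl]; exact fun h => hi (Nat.dvd_of_mod_eq_zero h)⟩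

/-- **MODE 1h TERMINATES FROM EVERY PURE LEAF OVER `𝔽_p`, EVERY PRIME `p`** (every tie-break, every `𝔽_p`-rational reply).
[OURS · counted 0] [folklore] -/
theorem no_step1h_chain_monomial_zmod (a : Fin 4 → ℕ) (ha : ∃ i, ¬ p ∣ a i) (r : Fin 4 →₀ ℕ)
    (exc : Finset (Fin 4)) :
    ¬ ∃ ch : ℕ → State (ZMod p),
      ch 0 = (⟨monomial (Finsupp.equivFunOnFinite.symm a) 1, r, exc⟩ : State (ZMod p)) ∧
        ∀ k, Step1h p (ch k) (ch (k + 1)) := by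
  rw [monomial_eq_generalForm p a ha]
  refine ((classWins p _ (fun (i : Fin 4) (c : ZMod p) => if c = 0 then a i / p else 0)
    (fun (i : Fin 4) (c : ZMod p) => if c = 0 then a i % p else 0) le_rfl
    (fun i c => ?_) (fun i c hc c' hc' => ?_) (fun i c hc c' hc' => ?_) ?_ r exc)).2
  · split_ifs
    · exact Nat.mod_lt _ (Fact.out : p.Prime).pos
    · exact (Fact.out : p.Prime).pos
  · by_cases hc0 : c = 0
    · rw [if_neg (fun h => hc' (h.trans hc0.symm))]
    · rw [if_neg hc0] at hc; exact absurd rfl hc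
  · by_cases hc0 : c = 0
    · rw [if_neg (fun h => hc' (h.trans hc0.symm))]
    · rw [if_neg hc0] at hc; exact absurd rfl hc
  · obtain ⟨i, hi⟩ := ha
    exact ⟨i, 0, by rw [if_pos rfl]; exact fun h => hi (Nat.dvd_of_mod_eq_zero h)⟩

/-- The `Fin 4 →₀ ℕ` forms (the shape of `PureLeafGlobalWinQuestion`, every prime). [OURS · counted 0] [folklore] -/
theorem stateWins_monomial_zmod' (a : Fin 4 →₀ ℕ) (ha : ∃ i, ¬ p ∣ a i) (r : Fin 4 →₀ ℕ) (exc : Finset (Fin 4)) :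
    StateWins p (⟨monomial a 1, r, exc⟩ : State (ZMod p)) := by
  have h := stateWins_monomial_zmod p (⇑a) ha r exc
  rwa [Finsupp.equivFunOnFinite_symm_coe] at h

end PureLeafNF

end Summit.ResolutionOfSingularities.ResolutionOfSingularities.Theorems.PIDim4

end
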